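import Summits.RiemannHypothesis.RiemannHypothesis.Theorems.RuelleBandCofiniteCriticalLineStubCalibrationENDOfRHAux2
import HarnessLib

set_option linter.dupNamespace false

/-!
# Stub `stub_entire_eq_zero_of_levinson` — too many distinct zeros (Levinson–Anderson, no RH)

Stub C3 of line `cofinite-weil-index-staircase` (crux `RuelleBand.CofiniteCriticalLine`): an entire
function of exponential type in `Re s`, `‖f(s)‖ ≤ B e^{A |Re s − 1/2|}`, that vanishes at every
non-trivial zero of `ζ` is identically zero, assuming only the named fact
`Anderson1983_levinson_simple` (at least a third of the zeros are simple and on the critical line)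
instead of RH:

* Jensen (`stub_calibration_END_of_RH_card_zeros_le`): about a point `s₀` with `f(s₀) ≠ 0`, the
  distinct zeros `ρ` of `ζ` with `0 < Im ρ ≤ T` (all of which lie in the disc of radius
  `T + 1 + |s₀ − 1/2|` about `s₀`, since `0 ≤ Re ρ ≤ 1` — no RH needed) number at most `αT + β`;
* `N_d(T) ≥ N⁽¹⁾(T) ≥ N(T)/3` for large `T` (`Anderson1983_levinson_simple.third` and the elementary
  `simpleCriticalZeroCount T ≤ distinctZeroCount T`), while `(T/2π) log T ≤ 2 N(T)` eventually
  (Riemann–von Mangoldt, `ZeroGapsProofs.eventually_mul_log_le`): contradiction with `log T → ∞`.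
-/

noncomputable section

open Complex MeasureTheory Filter Set
open scoped BigOperators Topology ComplexConjugate Real

namespace Summit.RiemannHypothesis.RiemannHypothesis.Theorems.RuelleBandCofiniteCriticalLine

open Literature.NumberTheory.LFunctions

/-- `N⁽¹⁾(T) ≤ N_d(T)`: the simple zeros on the critical segment `0 < Im ρ ≤ T` are among the
distinct zeros of the box `0 ≤ Re ρ ≤ 1`, `0 < Im ρ ≤ T` (`zetaZeroBox (1/2) T ⊆ zetaZeroBox 0 T`).
[folklore] -/
theorem stub_entire_eq_zero_of_levinson_simple_le_distinct (T : ℝ) :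
    simpleCriticalZeroCount T ≤ distinctZeroCount T := by
  unfold simpleCriticalZeroCount distinctZeroCount
  refine Set.ncard_le_ncard ?_ (zetaZeroBox_finite 0 T)
  rintro ρ ⟨⟨h0, h1, h2, h3, h4⟩, -⟩
  exact ⟨h0, by linarith, h2, h3, h4⟩

/-- **Too many distinct zeros (Levinson–Anderson instead of RH).** An entire function `f` with
`‖f(s)‖ ≤ B e^{A |Re s − 1/2|}` (`A ≥ 0`) vanishing at every non-trivial zero of `ζ` is identically
zero, granted `Anderson1983_levinson_simple`: otherwise Jensen's inequality about a point `s₀` with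
`f(s₀) ≠ 0` bounds the number of distinct zeros of `ζ` with `0 < Im ρ ≤ T` (which lie in
`|s − s₀| ≤ T + 1 + |s₀ − 1/2|` as `0 ≤ Re ρ ≤ 1`) by `αT + β`, contradicting
`N_d(T) ≥ N⁽¹⁾(T) ≥ N(T)/3 ≥ (T/12π) log T` for large `T` (`Anderson1983_levinson_simple.third`,
`ZeroGapsProofs.eventually_mul_log_le`). [folklore] -/
theorem stub_entire_eq_zero_of_levinson : Anderson1983_levinson_simple → ∀ {f : ℂ → ℂ},
    Differentiable ℂ f → ∀ {A B : ℝ}, 0 ≤ A →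
      (∀ s : ℂ, ‖f s‖ ≤ B * Real.exp (A * |s.re - 1 / 2|)) →
        (∀ ρ ∈ ZetaZeros.riemannZetaNontrivialZeros, f ρ = 0) → ∀ s : ℂ, f s = 0 := by
  intro hAnd f hf A B hA hgrowth hzero
  by_contra hne
  push Not at hne
  obtain ⟨s₀, hs₀⟩ := hne
  have hfs₀ : 0 < ‖f s₀‖ := norm_pos_iff.2 hs₀
  set d : ℝ := ‖s₀ - 1 / 2‖ with hd
  have hd0 : 0 ≤ d := norm_nonneg _
  set B' : ℝ := max B 1 with hB'
  have hB'1 : 1 ≤ B' := le_max_right _ _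
  have hB'pos : 0 < B' := one_pos.trans_le hB'1
  have hlog2 : 0 < Real.log 2 := Real.log_pos one_lt_two
  set α : ℝ := 2 * A / Real.log 2 with hα
  set β : ℝ := (Real.log B' + 3 * A * d + 2 * A - Real.log ‖f s₀‖) / Real.log 2 with hβ
  have hα0 : 0 ≤ α := div_nonneg (by positivity) hlog2.le
  -- Jensen: `N_d(T) ≤ α T + β` for every `T > 0`
  have hJ : ∀ T : ℝ, 0 < T → (distinctZeroCount T : ℝ) ≤ α * T + β := by
    intro T hT
    set r : ℝ := T + d + 1 with hr
    have hr0 : 0 < r := by positivity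
    set R : ℝ := 2 * r with hR
    set M : ℝ := B' * Real.exp (A * (R + d)) with hM
    have hM1 : 1 ≤ M := by
      have h1 : 1 ≤ Real.exp (A * (R + d)) := Real.one_le_exp (by positivity)
      nlinarith
    have hMpos : 0 < M := one_pos.trans_le hM1
    have hbound : ∀ z ∈ Metric.sphere s₀ R, ‖f z‖ ≤ M := by
      intro z hz
      rw [Metric.mem_sphere, dist_eq_norm] at hz
      have h1 : |z.re - 1 / 2| ≤ R + d := by
        have h2 : |z.re - 1 / 2| ≤ ‖z - 1 / 2‖ := by
          simpa [sub_re] using abs_re_le_norm (z - 1 / 2)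
        have h3 : ‖z - 1 / 2‖ ≤ ‖z - s₀‖ + ‖s₀ - 1 / 2‖ := norm_sub_le_norm_sub_add_norm_sub _ _ _
        linarith
      calc ‖f z‖ ≤ B * Real.exp (A * |z.re - 1 / 2|) := hgrowth z
        _ ≤ B' * Real.exp (A * |z.re - 1 / 2|) :=
            mul_le_mul_of_nonneg_right (le_max_left _ _) (Real.exp_pos _).le
        _ ≤ B' * Real.exp (A * (R + d)) :=
            mul_le_mul_of_nonneg_left (Real.exp_le_exp.2
              (mul_le_mul_of_nonneg_left h1 hA)) hB'pos.le
    set Z : Finset ℂ := (zetaZeroBox_finite 0 T).toFinset with hZ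
    have hZmem : ∀ z ∈ Z, z ∈ Metric.closedBall s₀ r ∧ f z = 0 := by
      intro z hz
      rw [hZ, Set.Finite.mem_toFinset] at hz
      have hnt := zetaZeroBox_subset_riemannZetaNontrivialZeros 0 T hz
      obtain ⟨-, hre0, hre1, him0, himT⟩ := hz
      refine ⟨?_, hzero z hnt⟩
      -- no RH: `‖z − 1/2‖ ≤ |Re z − 1/2| + |Im z| ≤ 1/2 + T` since `0 ≤ Re z ≤ 1`, `0 < Im z ≤ T`
      have hre : |(z - 1 / 2).re| ≤ 1 / 2 := by
        have e : (z - 1 / 2).re = z.re - 1 / 2 := by simp [sub_re]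
        rw [e, abs_le]
        constructor <;> linarith
      have him : |(z - 1 / 2).im| ≤ T := by
        have e : (z - 1 / 2).im = z.im := by simp [sub_im]
        rw [e, abs_le]
        constructor <;> linarith
      have hn : ‖z - 1 / 2‖ ≤ 1 / 2 + T :=
        (Complex.norm_le_abs_re_add_abs_im _).trans (add_le_add hre him)
      rw [Metric.mem_closedBall, dist_eq_norm]
      calc ‖z - s₀‖ ≤ ‖z - 1 / 2‖ + ‖1 / 2 - s₀‖ := norm_sub_le_norm_sub_add_norm_sub _ _ _
        _ ≤ (1 / 2 + T) + d := by rw [hd, norm_sub_rev (s₀ : ℂ)]; linarith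
        _ ≤ r := by rw [hr]; linarith
    have hcard := stub_calibration_END_of_RH_card_zeros_le hf hr0 (by linarith) hM1 hs₀
      hbound Z hZmem
    have hcardeq : (distinctZeroCount T : ℝ) = Z.card := by
      rw [distinctZeroCount, Set.ncard_eq_toFinset_card _ (zetaZeroBox_finite 0 T)]
    have hRr : R / r = 2 := by rw [hR]; field_simp
    have hlogM : Real.log (M / ‖f s₀‖) =
        2 * A * T + (Real.log B' + 3 * A * d + 2 * A - Real.log ‖f s₀‖) := by
      rw [Real.log_div hMpos.ne' hfs₀.ne', hM, Real.log_mul hB'pos.ne' (Real.exp_pos _).ne',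
        Real.log_exp, hR, hr]
      ring
    rw [hRr, hlogM] at hcard
    rw [hcardeq]
    calc (Z.card : ℝ) ≤ _ := hcard
      _ = α * T + β := by rw [hα, hβ]; ring
  -- Levinson–Anderson (a third of the zeros are simple and critical) and Riemann–von Mangoldt
  obtain ⟨T₀, hT₀⟩ := Anderson1983_levinson_simple.third hAnd
  have h2 := ZeroGapsProofs.eventually_mul_log_le (ε := 1) one_pos
  obtain ⟨T, hT1, hTlog, hTT₀, hRvM⟩ := ((eventually_ge_atTop (1 : ℝ)).and
    ((Real.tendsto_log_atTop.eventually_ge_atTop (12 * π * (α + |β|) + 1)).and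
      ((eventually_ge_atTop T₀).and h2))).exists
  have hT0 : 0 < T := one_pos.trans_le hT1
  have hπ : 0 < π := Real.pi_pos
  have hJT := hJ T hT0
  have hthird := hT₀ T hTT₀
  have hsd : (simpleCriticalZeroCount T : ℝ) ≤ distinctZeroCount T := by
    exact_mod_cast stub_entire_eq_zero_of_levinson_simple_le_distinct T
  have hN : (zetaZeroCount T : ℝ) ≤ 3 * (α * T + β) := by linarith
  have h3 : T / (2 * π) * Real.log T ≤ 6 * (α * T + β) := by linarith
  have h4 : β ≤ |β| * T := (le_abs_self β).trans (le_mul_of_one_le_right (abs_nonneg β) hT1)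
  have h5 : T * Real.log T ≤ T * (12 * π * (α + |β|)) := by
    rw [div_mul_eq_mul_div, div_le_iff₀ (by positivity)] at h3
    nlinarith
  have h6 : Real.log T ≤ 12 * π * (α + |β|) := le_of_mul_le_mul_left h5 hT0
  linarith

/-- Curried form of `stub_entire_eq_zero_of_levinson`. [folklore] -/
theorem stub_entire_eq_zero_of_levinson' (hAnd : Anderson1983_levinson_simple) {f : ℂ → ℂ}
    (hf : Differentiable ℂ f) {A B : ℝ} (hA : 0 ≤ A)
    (hgrowth : ∀ s : ℂ, ‖f s‖ ≤ B * Real.exp (A * |s.re - 1 / 2|))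
    (hzero : ∀ ρ ∈ ZetaZeros.riemannZetaNontrivialZeros, f ρ = 0) (s : ℂ) : f s = 0 :=
  stub_entire_eq_zero_of_levinson hAnd hf hA hgrowth hzero s

end Summit.RiemannHypothesis.RiemannHypothesis.Theorems.RuelleBandCofiniteCriticalLine

end
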